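import Literature.NumberTheory.GaloisRepresentations.ContinuousShapiroLiftCores
import Literature.NumberTheory.EllipticCurves.SubgroupKummerClass
import Literature.NumberTheory.EllipticCurves.WeilPairingTateDual
import Literature.NumberTheory.GaloisCohomology.LocalInvariantMap
import Summits.BirchSwinnertonDyer.BirchSwinnertonDyer.Theorems.ThetaPartnerAtTwoSignedKatoUpToAtTwoLocalCoresCompat
import Literature.NumberTheory.EllipticCurves.Sprung2012.ColemanMapLambdaActionProofs
import HarnessLib

/-!
# Route `ThetaPartnerAtTwo` (TP2), crux K3 `SignedKatoDivisibilityUpToAtTwo` (item stmt-BirchSwinnertonDyer-20308),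
# line `colemanrat` v7 — (D-layer) DEFINITIONS: the finite-coefficient local Tate pairing AT A LAYER of the cyclotomic
# tower in the SHAPIRO MODEL, `⟨x, Q⟩_{n,N} = inv_v( Sh_n(loc_n x) ∪_{Σe} Sh_n(κ_{U_n}(Q)) ) ∈ ℤ/N`

Width seat `bsd-wall-tp2-p2x-w3` g4 (cell `bsd-wall`). DEFINITIONS WITH BODIES and unfolding lemmas only (objects the
line `colemanrat` posits: the (D-layer) definition item of the research stub
`Cruxes.SignedKatoDivisibilityUpToAtTwo.ColemanRat.stub_layerSideTwoInv`); no named fact, no instance, no notation, no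
`sorry`; nothing about BSD is claimed.

## The objects (for `W/ℚ` elliptic, a level `N ≥ 1`, a Weil pairing datum `e` on `E[N]` — the hypotheses of the tree's
## `WeilPairingTateDual.lean`, supplied by `WeierstrassCurve.exists_weilPairing_holds` — a `ℤ_p`-extension `κ` of `ℚ`,
## a finite place `v`, and a layer `n`; `ℚ_v = v.adicCompletion ℚ`, `Γ_v = Gal(ℚ̄_v/ℚ_v)`, `ι = closureEmb ℚ_v`)

* `torsionLocalRep W N v = E[N](ℚ̄)|_{Γ_v}` and `muLocalRep N v = μ_N(ℚ̄)|_{Γ_v}` (the restricted discrete modules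
  of `KummerSelmerStructure.lean` / `LocalTatePairing.lean`, as `TopRep`s), and the LOCAL WEIL PAIRING
  `weilLocalPairing : E[N]| × E[N]| → μ_N|` (a `ContPairing`; the tree's `weilContPairingLocal` at the `K`-field `ℚ_v`).
* `layerGroup κ v n = U_n = Gal(ℚ̄_v/ℚ_{n,v}) = localSubgroupOfEmb (Γ_n) ι ≤ Γ_v` (open, normal, finite index), a chosen
  system `layerReps` of representatives of `Γ_v ⧸ U_n` with `s(1) = 1`.
* `layerLoc W N κ v n : H¹(Γ_n, E[N]) → H¹(U_n, E[N]|)` — localisation at the layer (pull back along `U_n → Γ_n`).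
* `layerShapiro W N κ v n : H¹(U_n, E[N]|) →ₗ[ℤ] H¹(Γ_v, Maps(Γ_v ⧸ U_n, E[N]|))` — the tree's degree-one Shapiro
  isomorphism `shapiroLift` (`ContinuousShapiroLiftCores.lean`).
* `layerSumPairing … n : Maps(Γ_v ⧸ U_n, E[N]|) × Maps(Γ_v ⧸ U_n, E[N]|) → μ_N|`, `⟨φ, ψ⟩ = Σ_y e(φ y, ψ y)` (the tree's
  `ContPairing.coindFin` of the local Weil pairing).
* `invAt N v : H²(Γ_v, μ_N|) →+ ℤ/N` — THE local invariant map (`localInvariantMap ℚ N v`, read on `ℚ_v`).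
* **`layerPairingMod W N e … κ v n : H¹(Γ_n, E[N]) →+ (E(ℚ_{n,v}) →+ ℤ/N)`**,
  `x ↦ (Q ↦ inv_v( Sh_n(loc_n x) ∪ Sh_n(κ_{U_n,N}(Q)) ))`, where `κ_{U_n,N} = subgroupKummerMap` is the Kummer map of the
  layer (`SubgroupKummerClass.lean`) and `E(ℚ_{n,v}) = localLayerPointsOfEmb κ ι W n`.  By Shapiro
  (`cor = H(norm) ∘ Sh⁻¹`) this is `inv_{ℚ_{n,v}}(loc x ∪_e κ(Q))`, the local Tate pairing of the LAYER FIELD `ℚ_{n,v}`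
  with coefficients `E[N]`, i.e. Kobayashi's `( , )_n` (8.23) modulo `N` / Perrin-Riou's finite-level pairing.

The theorem files `…LayerPairingModProjection.lean` / `…LayerPairingModGalois.lean` prove the projection formula (P1)
across layers and the Galois invariance (P2) of these pairings; the `T_pE`-adic layer pairing of the stub is their
`ℤ_p`-limit over `N = p^k` (w2's `…LayerPairingLimit.lean`).

References: [Kobayashi2003] (8.23) (p. 18); [PerrinRiou1994Invent] §3.6.1; [Kato2004Asterisque] §13.8; [MilneADT2006] I §2,
I §6 (proof of Prop. 6.9); [NeukirchSchmidtWingberg2008] I §5–§6; [SerreLocalFields1979] VII §5–§6.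
-/

set_option autoImplicit false
-- the Theorems namespace of this sub repeats the summit name by design (D-0017 nested layout)
set_option linter.dupNamespace false

noncomputable section

open scoped Classical

namespace Summit.BirchSwinnertonDyer.BirchSwinnertonDyer.Theorems

namespace SignedKatoOffTwo.LayerPairing

open CategoryTheory Field NumberField IsDedekindDomain WeierstrassCurve
  Literature.NumberTheory.EllipticCurves Literature.NumberTheory.GaloisRepresentations
  Literature.NumberTheory.EllipticCurves.Kobayashi2003 Literature.NumberTheory.EllipticCurves.Sprung2012
  Literature.NumberTheory.GaloisCohomology ZpExtension

-- Cup products need `LocallyCompactSpace Γ`; as in `WeilPairingTateDual.lean` the compactness of absolute Galois groups is a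
-- local instance only.
attribute [local instance] absoluteGaloisGroup_compactSpace

variable (W : WeierstrassCurve ℚ) [W.IsElliptic] (N : ℕ) [NeZero N]
  (e : geomTorsion W N → geomTorsion W N → AlgebraicClosure ℚ)
  (hμ : ∀ S T, e S T ^ N = 1)
  (hadd₁ : ∀ S₁ S₂ T, e (S₁ + S₂) T = e S₁ T * e S₂ T)
  (hadd₂ : ∀ S T₁ T₂, e S (T₁ + T₂) = e S T₁ * e S T₂)
  (hgal : ∀ (σ : absoluteGaloisGroup ℚ) (S T : geomTorsion W N), σ • e S T = e (σ • S) (σ • T))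
  {p : ℕ} [Fact p.Prime] (κ : ZpExtension ℚ p) (v : HeightOneSpectrum (𝓞 ℚ))

attribute [local instance] finite_geomTorsion_of_neZero

/-! ## §1 The local coefficient modules and the local Weil pairing at `ℚ_v` -/

/-- `E[N](ℚ̄)|_{Γ_v}`: the `N`-torsion of `W` as a discrete `Γ_{ℚ_v}`-module (restriction along `Γ_{ℚ_v} → Γ_ℚ` for the
chosen embedding), as a `TopRep` — the coefficients of `KummerSelmerStructure`/`SubgroupKummerClass`.
[cite: SilvermanAEC2009, X §4] -/
abbrev torsionLocalRep : TopRep ℤ (absoluteGaloisGroup (v.adicCompletion ℚ)) :=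
  DiscreteGaloisModule.toTopRep (GaloisRep.restrictField (v.adicCompletion ℚ) (W.torsionGaloisModule (N : ℤ)))

/-- `μ_N(ℚ̄)|_{Γ_v}` as a `TopRep` (the coefficients of `localInvariantMap ℚ N v`). [cite: MilneADT2006, Ch. I §2] -/
abbrev muLocalRep : TopRep ℤ (absoluteGaloisGroup (v.adicCompletion ℚ)) :=
  DiscreteGaloisModule.toTopRep (GaloisRep.restrictField (v.adicCompletion ℚ) (DiscreteGaloisModule.mu ℚ N))

/-- **The local Weil pairing** `E[N]| × E[N]| → μ_N|` at `ℚ_v` as a continuous equivariant pairing (the tree's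
`weilContPairingLocal` at the `ℚ`-field `ℚ_v`). [cite: MilneADT2006, Ch. I §6, proof of Prop. 6.9] [cite: SilvermanAEC2009, III §8] -/
def weilLocalPairing : ContPairing (torsionLocalRep W N v) (torsionLocalRep W N v) (muLocalRep N v) :=
  DiscreteGaloisModule.pairing (GaloisRep.restrictField (v.adicCompletion ℚ) (W.torsionGaloisModule (N : ℤ)))
    (GaloisRep.restrictField (v.adicCompletion ℚ) (W.torsionGaloisModule (N : ℤ)))
    (GaloisRep.restrictField (v.adicCompletion ℚ) (DiscreteGaloisModule.mu ℚ N)) (weilPairingHom W N e hμ hadd₁ hadd₂) fun σ S T =>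
      (weilContPairing W N e hμ hadd₁ hadd₂ hgal).toLin_smul (absGaloisRestrict ℚ (v.adicCompletion ℚ) σ) S T

omit [W.IsElliptic] in
/-- Unfolding `weilLocalPairing`: its bilinear map is `weilPairingHom`. [cite: SilvermanAEC2009, III §8] -/
@[simp] theorem weilLocalPairing_toLin_apply (S T : geomTorsion W N) :
    (weilLocalPairing W N e hμ hadd₁ hadd₂ hgal v).toLin S T = weilPairingHom W N e hμ hadd₁ hadd₂ S T := rfl

/-- **THE local invariant map at `v`, read on `H²(Γ_{ℚ_v}, μ_N|)`** (`localInvariantMap ℚ N v`; the completion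
`Place.Completion (Sum.inr v)` of the Poitou–Tate dialect is `v.adicCompletion ℚ` definitionally). [cite: MilneADT2006, Ch. I §1, Cor. 2.3] -/
def invAt : continuousCohomology 2 (muLocalRep N v) →+ ZMod N :=
  localInvariantMap ℚ N v

/-! ## §2 The layer groups `U_n ≤ Γ_v`, representatives, localisation, Shapiro -/

/-- `U_n = Gal(ℚ̄_v/ℚ_{n,v})`: the local subgroup of the `n`-th layer `Γ_n` of `κ` for the chosen embedding
(`= localLayerSubgroupOfEmb κ (closureEmb ℚ_v) n`). [cite: Kobayashi2003, Def. 1.1] -/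
abbrev layerGroup (n : ℕ) : Subgroup (absoluteGaloisGroup (v.adicCompletion ℚ)) :=
  localSubgroupOfEmb (κ.layerSubgroup n) (closureEmb (K := ℚ) (v.adicCompletion ℚ))

/-- `U_n` is normal in `Γ_v` (preimage of the normal subgroup `Γ_n ⊴ Γ_ℚ`). [cite: Kobayashi2003, Def. 1.1] -/
theorem normal_layerGroup (n : ℕ) : (layerGroup κ v n).Normal :=
  Subgroup.Normal.comap inferInstance _

/-- `U_n` is open. [cite: Kobayashi2003, Def. 1.1] -/
theorem isOpen_layerGroup (n : ℕ) : IsOpen (layerGroup κ v n : Set (absoluteGaloisGroup (v.adicCompletion ℚ))) :=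
  (κ.isOpen_layerSubgroup n).preimage (map_continuous (resGalOfEmb _))

/-- A chosen system of representatives of `Γ_v ⧸ U_n` with `s(1·U_n) = 1` (any other gives the same maps on classes:
`shapiroLift_eq_of_reps`). [cite: NeukirchSchmidtWingberg2008, I §5] -/
def layerReps (n : ℕ) : absoluteGaloisGroup (v.adicCompletion ℚ) ⧸ layerGroup κ v n → absoluteGaloisGroup (v.adicCompletion ℚ) :=
  Classical.choose (exists_reps_one (layerGroup κ v n))

/-- `layerReps` are representatives. [cite: NeukirchSchmidtWingberg2008, I §5] -/
theorem layerReps_spec (n : ℕ) (x : absoluteGaloisGroup (v.adicCompletion ℚ) ⧸ layerGroup κ v n) :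
    (layerReps κ v n x : absoluteGaloisGroup (v.adicCompletion ℚ) ⧸ layerGroup κ v n) = x :=
  (Classical.choose_spec (exists_reps_one (layerGroup κ v n))).1 x

/-- `layerReps (1·U_n) = 1`. [cite: NeukirchSchmidtWingberg2008, I §5] -/
theorem layerReps_one (n : ℕ) :
    layerReps κ v n ((1 : absoluteGaloisGroup (v.adicCompletion ℚ)) : absoluteGaloisGroup (v.adicCompletion ℚ) ⧸ layerGroup κ v n) = 1 :=
  (Classical.choose_spec (exists_reps_one (layerGroup κ v n))).2

/-- `Γ_v ⧸ U_n` is finite (`U_n` open in the compact `Γ_v`): a `Fintype` structure, as a definition (used uniformly by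
the constructions below, so that all of them carry the same instance term). [cite: SerreLocalFields1979, VII §5] -/
@[reducible]
def layerFintypeQuot (n : ℕ) : Fintype (absoluteGaloisGroup (v.adicCompletion ℚ) ⧸ layerGroup κ v n) :=
  haveI : (layerGroup κ v n).FiniteIndex := finiteIndex_of_isOpen_of_compactSpace _ (isOpen_layerGroup κ v n)
  Fintype.ofFinite _

/-- **Localisation at the layer**: `loc_n : H¹(Γ_n, E[N]) → H¹(U_n, E[N]|)`, pull-back along `U_n → Γ_n`
(`resGalSubgroupOfEmb`), identity on coefficients. [cite: Kobayashi2003, (8.23) (p. 18)] -/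
def layerLoc (n : ℕ) :
    H1 (W.torsionGaloisModule (N : ℤ)) (κ.layerSubgroup n) ⟶
      continuousCohomology 1 (subgroupRep (torsionLocalRep W N v) (layerGroup κ v n)) :=
  ContinuousCohomology.map (resGalSubgroupOfEmb (κ.layerSubgroup n) (closureEmb (K := ℚ) (v.adicCompletion ℚ)))
    (X := subgroupRep (W.torsionGaloisModule (N : ℤ)).toTopRep (κ.layerSubgroup n))
    (Y := subgroupRep (torsionLocalRep W N v) (layerGroup κ v n))
    (TopRep.ofHom ⟨ContinuousLinearMap.id ℤ (geomTorsion W N), fun _ => rfl⟩) 1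

/-- **The Shapiro isomorphism at the layer**: `Sh_n : H¹(U_n, E[N]|) →ₗ[ℤ] H¹(Γ_v, Maps(Γ_v ⧸ U_n, E[N]|))`
(`shapiroLift` for the chosen representatives). [cite: NeukirchSchmidtWingberg2008, I §6 Prop. (1.6.4)] -/
def layerShapiro (n : ℕ) :
    continuousCohomology 1 (subgroupRep (torsionLocalRep W N v) (layerGroup κ v n)) →ₗ[ℤ]
      continuousCohomology 1 (coindFin.{0, 0} (torsionLocalRep W N v) (layerGroup κ v n)) :=
  shapiroLift (torsionLocalRep W N v) (layerGroup κ v n) (isOpen_layerGroup κ v n) (layerReps_spec κ v n)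
    (layerReps_one κ v n)

/-- **The conjugation action of `g ∈ Γ_v` on `H¹(U_n, E[N]|)`** (`conjMap` of `ContinuousCorestriction.lean`, with the
normality of `U_n` supplied). [cite: SerreLocalFields1979, VII §5] -/
def layerConj (n : ℕ) (g : absoluteGaloisGroup (v.adicCompletion ℚ)) :
    continuousCohomology 1 (subgroupRep (torsionLocalRep W N v) (layerGroup κ v n)) ⟶
      continuousCohomology 1 (subgroupRep (torsionLocalRep W N v) (layerGroup κ v n)) :=
  haveI := normal_layerGroup κ v n
  conjMap (torsionLocalRep W N v) (layerGroup κ v n) g 1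

/-! ## §3 The summed pairing and the layer pairing modulo `N` -/

/-- **The summed local Weil pairing at layer `n`**: `Maps(Γ_v ⧸ U_n, E[N]|) × Maps(Γ_v ⧸ U_n, E[N]|) → μ_N|`,
`⟨φ, ψ⟩ = Σ_y e(φ y, ψ y)` (the tree's `ContPairing.coindFin`; `Γ_v ⧸ U_n` is finite: `U_n` open in the compact `Γ_v`).
[cite: NeukirchSchmidtWingberg2008, I §5 Prop. (1.5.3)(iv)] -/
def layerSumPairing (n : ℕ) :
    ContPairing (coindFin.{0, 0} (torsionLocalRep W N v) (layerGroup κ v n))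
      (coindFin.{0, 0} (torsionLocalRep W N v) (layerGroup κ v n)) (muLocalRep N v) :=
  haveI : Fintype (absoluteGaloisGroup (v.adicCompletion ℚ) ⧸ layerGroup κ v n) := layerFintypeQuot κ v n
  (weilLocalPairing W N e hμ hadd₁ hadd₂ hgal v).coindFin (layerGroup κ v n)

/-- **The Kummer map of the layer** `E(ℚ_{n,v}) →+ H¹(U_n, E[N]|)` (`subgroupKummerMap` of `SubgroupKummerClass.lean` for
`U = U_n`; `E(ℚ_{n,v}) = localLayerPointsOfEmb κ ι W n = E(ℚ̄_v)^{U_n}`). [cite: Kobayashi2003, §2 (p. 4)] [cite: SilvermanAEC2009, VIII §2] -/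
def layerKummer (n : ℕ) :
    localLayerPointsOfEmb κ (closureEmb (K := ℚ) (v.adicCompletion ℚ)) W n →+
      continuousCohomology 1 (subgroupRep (torsionLocalRep W N v) (layerGroup κ v n)) :=
  W.subgroupKummerMap (N : ℤ) (layerGroup κ v n) (by exact_mod_cast (NeZero.ne N))

/-- **The layer pairing modulo `N`** — the (D-layer) object at finite level:
`⟨x, Q⟩_{n,N} = inv_v( Sh_n(loc_n x) ∪_{Σe} Sh_n(κ_{U_n}(Q)) ) ∈ ℤ/N` for `x ∈ H¹(Γ_n, E[N])`, `Q ∈ E(ℚ_{n,v})`; bi-additive.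
By Shapiro this is the local Tate pairing `inv_{ℚ_{n,v}}(loc x ∪_e κ(Q))` of the layer field with coefficients `E[N]`
(Kobayashi's `( , )_n` modulo `N`). [cite: Kobayashi2003, (8.23) (p. 18)] [cite: PerrinRiou1994Invent, §3.6.1]
[cite: MilneADT2006, Ch. I §6, proof of Prop. 6.9] -/
def layerPairingMod (n : ℕ) :
    H1 (W.torsionGaloisModule (N : ℤ)) (κ.layerSubgroup n) →+
      (localLayerPointsOfEmb κ (closureEmb (K := ℚ) (v.adicCompletion ℚ)) W n →+ ZMod N) where
  toFun x := (invAt N v).comp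
    ((((layerSumPairing W N e hμ hadd₁ hadd₂ hgal κ v n).cupProduct
        (layerShapiro W N κ v n (layerLoc W N κ v n x))).toAddMonoidHom.comp
      (layerShapiro W N κ v n).toAddMonoidHom).comp (layerKummer W N κ v n))
  map_zero' := by
    ext Q
    simp only [map_zero, LinearMap.zero_apply, AddMonoidHom.coe_comp, Function.comp_apply,
      LinearMap.toAddMonoidHom_coe, AddMonoidHom.zero_apply]
  map_add' x y := by
    ext Q
    simp only [map_add, LinearMap.add_apply, AddMonoidHom.coe_comp, Function.comp_apply,
      LinearMap.toAddMonoidHom_coe, AddMonoidHom.add_apply]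

/-- **Unfolding the layer pairing**: `⟨x, Q⟩_{n,N} = inv_v (Sh_n(loc_n x) ∪ Sh_n(κ_{U_n}(Q)))`.
[cite: Kobayashi2003, (8.23) (p. 18)] -/
theorem layerPairingMod_apply (n : ℕ) (x : H1 (W.torsionGaloisModule (N : ℤ)) (κ.layerSubgroup n))
    (Q : localLayerPointsOfEmb κ (closureEmb (K := ℚ) (v.adicCompletion ℚ)) W n) :
    layerPairingMod W N e hμ hadd₁ hadd₂ hgal κ v n x Q =
      invAt N v ((layerSumPairing W N e hμ hadd₁ hadd₂ hgal κ v n).cupProduct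
        (layerShapiro W N κ v n (layerLoc W N κ v n x)) (layerShapiro W N κ v n (layerKummer W N κ v n Q))) :=
  rfl

/-! ## §4 The projection formula (P1) across layers, modulo `N` -/

section Projection

variable (hκ : κ.IsCyclotomic) (hv : (p : 𝓞 ℚ) ∈ v.asIdeal)

/-- `U_{n+1} ≤ U_n`. [cite: Kobayashi2003, Def. 1.1] -/
theorem layerGroup_antitone (n : ℕ) : layerGroup κ v (n + 1) ≤ layerGroup κ v n :=
  LocalCores.localSubgroupOfEmb_mono _ (κ.layerSubgroup_antitone (Nat.le_succ n))

omit [W.IsElliptic] [NeZero N] in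
include hκ hv in
/-- **Localisation carries Kato's trace map to the local trace map** (`…LocalCoresCompat`, read on `torsionLocalRep`):
`loc_n (layerCores y) = cor_{U_{n+1} → U_n} (loc_{n+1} y)`. [cite: Kato2004Asterisque, §12.2 (p. 220)]
[cite: NeukirchSchmidtWingberg2008, I §5 Prop. (1.5.6)–(1.5.7)] -/
theorem layerLoc_layerCores (n : ℕ)
    [Fintype (layerGroup κ v n ⧸ (layerGroup κ v (n + 1)).subgroupOf (layerGroup κ v n))]
    (y : H1 (W.torsionGaloisModule (N : ℤ)) (κ.layerSubgroup (n + 1))) :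
    layerLoc W N κ v n (Kato2004.layerCores (W.torsionGaloisModule (N : ℤ)) κ n y) =
      coresLe (torsionLocalRep W N v) (layerGroup_antitone κ v n) (isOpen_layerGroup κ v (n + 1))
        (layerLoc W N κ v (n + 1) y) :=
  LocalCores.map_resGalSubgroupOfEmb_layerCores_cyclotomic κ hκ v hv (W.torsionGaloisModule (N : ℤ)) n y

/-- `res_{U_{n+1}}^{U_n} κ_{U_n}(Q) = κ_{U_{n+1}}(Q)` for the layer Kummer maps (`resLe_subgroupKummerClass`).
[cite: SilvermanAEC2009, X §4] [cite: Kobayashi2003, §2 (p. 4)] -/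
theorem resLe_layerKummer (n : ℕ) (Q : localPoints W (v.adicCompletion ℚ))
    (hQ : Q ∈ localLayerPointsOfEmb κ (closureEmb (K := ℚ) (v.adicCompletion ℚ)) W n) :
    resLe (torsionLocalRep W N v) (layerGroup_antitone κ v n) 1 (layerKummer W N κ v n ⟨Q, hQ⟩) =
      layerKummer W N κ v (n + 1)
        ⟨Q, localLayerPointsOfEmb_mono κ (closureEmb (K := ℚ) (v.adicCompletion ℚ)) W (Nat.le_succ n) hQ⟩ := by
  have hN : (N : ℤ) ≠ 0 := by exact_mod_cast (NeZero.ne N)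
  have hroot : (N : ℤ) • W.subgroupZSMulRoot (N : ℤ) hN Q = Q := W.zsmul_subgroupZSMulRoot (N : ℤ) hN Q
  have hfix : (N : ℤ) • W.subgroupZSMulRoot (N : ℤ) hN Q ∈
      FixedPoints.addSubgroup (layerGroup κ v n) (localPoints W (v.adicCompletion ℚ)) := by
    rw [hroot]; exact hQ
  change resLe (torsionLocalRep W N v) (layerGroup_antitone κ v n) 1
      (W.subgroupKummerMap (N : ℤ) (layerGroup κ v n) hN
        (⟨Q, hQ⟩ : FixedPoints.addSubgroup (layerGroup κ v n) (localPoints W (v.adicCompletion ℚ)))) =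
    W.subgroupKummerMap (N : ℤ) (layerGroup κ v (n + 1)) hN
      (⟨Q, localLayerPointsOfEmb_mono κ (closureEmb (K := ℚ) (v.adicCompletion ℚ)) W (Nat.le_succ n) hQ⟩ :
        FixedPoints.addSubgroup (layerGroup κ v (n + 1)) (localPoints W (v.adicCompletion ℚ)))
  rw [W.subgroupKummerMap_apply_eq (N : ℤ) (layerGroup κ v n) hN _ _ hfix hroot,
    W.resLe_subgroupKummerClass (N : ℤ) hN (layerGroup_antitone κ v n),
    W.subgroupKummerMap_apply_eq (N : ℤ) (layerGroup κ v (n + 1)) hN _ _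
      (W.fixedPoints_addSubgroup_antitone (layerGroup_antitone κ v n) hfix) hroot]

omit [NeZero N] [Fact p.Prime] in
/-- `H²(𝟙) = id` on `H²(Γ_v, μ_N|)`. [cite: NeukirchSchmidtWingberg2008, I §5] -/
theorem cohomologyMap_id_muLocalRep (c : continuousCohomology 2 (muLocalRep N v)) :
    cohomologyMap (𝟙 (muLocalRep N v)) 2 c = c := by
  rw [show cohomologyMap (𝟙 (muLocalRep N v)) 2 = 𝟙 _ from map_id_eq_id _ (fun _ => rfl) 2]
  rfl

include hκ hv in
/-- **(P1) modulo `N` — the projection formula across layers**: for `y ∈ H¹(Γ_{n+1}, E[N])` and `Q ∈ E(ℚ_{n,v})`,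
`⟨cor y, Q⟩_{n,N} = ⟨y, Q⟩_{n+1,N}`.  Assembly: localisation carries `cor` to the local `cor` (`layerLoc_layerCores`);
Shapiro carries the local `cor` to the fibre sum `Σ` (`cohomologyMap_coindFinSum_shapiroLift`); `Σ` in the first slot is
adjoint to the pull-back in the second (`cupProduct_coindFinSum_left`); Shapiro carries the pull-back to restriction
(`cohomologyMap_coindFinRes_shapiroLift`); restriction of the layer Kummer class of `Q` over `ℚ_{n,v}` is its layer Kummer
class over `ℚ_{n+1,v}` (`resLe_layerKummer`). [cite: Kobayashi2003, (8.23) (p. 18)] [cite: PerrinRiou1994Invent, §3.6.1]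
[cite: NeukirchSchmidtWingberg2008, I §5 Prop. (1.5.3)(iv)] -/
theorem layerPairingMod_layerCores (n : ℕ) (y : H1 (W.torsionGaloisModule (N : ℤ)) (κ.layerSubgroup (n + 1)))
    (Q : localPoints W (v.adicCompletion ℚ))
    (hQ : Q ∈ localLayerPointsOfEmb κ (closureEmb (K := ℚ) (v.adicCompletion ℚ)) W n) :
    layerPairingMod W N e hμ hadd₁ hadd₂ hgal κ v n (Kato2004.layerCores (W.torsionGaloisModule (N : ℤ)) κ n y) ⟨Q, hQ⟩ =
      layerPairingMod W N e hμ hadd₁ hadd₂ hgal κ v (n + 1) y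
        ⟨Q, localLayerPointsOfEmb_mono κ (closureEmb (K := ℚ) (v.adicCompletion ℚ)) W (Nat.le_succ n) hQ⟩ := by
  letI : Fintype (absoluteGaloisGroup (v.adicCompletion ℚ) ⧸ layerGroup κ v n) := layerFintypeQuot κ v n
  letI : Fintype (absoluteGaloisGroup (v.adicCompletion ℚ) ⧸ layerGroup κ v (n + 1)) := layerFintypeQuot κ v (n + 1)
  haveI : (layerGroup κ v (n + 1)).FiniteIndex := finiteIndex_of_isOpen_of_compactSpace _ (isOpen_layerGroup κ v (n + 1))
  haveI : Fintype (layerGroup κ v n ⧸ (layerGroup κ v (n + 1)).subgroupOf (layerGroup κ v n)) := Fintype.ofFinite _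
  rw [layerPairingMod_apply, layerPairingMod_apply, layerLoc_layerCores W N κ v hκ hv n y]
  unfold layerShapiro layerSumPairing
  rw [← cohomologyMap_coindFinSum_shapiroLift (torsionLocalRep W N v) (layerGroup_antitone κ v n) (isOpen_layerGroup κ v n)
      (isOpen_layerGroup κ v (n + 1)) (layerReps_spec κ v n) (layerReps_one κ v n) (layerReps_spec κ v (n + 1))
      (layerReps_one κ v (n + 1)),
    ← cohomologyMap_id_muLocalRep N v (ContPairing.cupProduct _ _ _),
    ContPairing.cupProduct_coindFinSum_left,
    cohomologyMap_coindFinRes_shapiroLift (torsionLocalRep W N v) (layerGroup_antitone κ v n) (isOpen_layerGroup κ v n)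
      (isOpen_layerGroup κ v (n + 1)) (layerReps_spec κ v n) (layerReps_one κ v n) (layerReps_spec κ v (n + 1))
      (layerReps_one κ v (n + 1)),
    resLe_layerKummer]

end Projection

/-! ## §5 Galois invariance (P2), modulo `N` -/

section Galois

omit [W.IsElliptic] [NeZero N] in
/-- **Localisation intertwines the conjugation actions**: for `g ∈ Γ_v` with image `g̃ ∈ Γ_ℚ`,
`loc_n (g̃ · y) = g · loc_n y` (`conjMap` on `H¹(Γ_n, E[N])` and on `H¹(U_n, E[N]|)`; both pull back along
`u ↦ g⁻¹ u g` and act by `g` on the coefficients). [cite: SerreLocalFields1979, VII §5] -/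
theorem layerLoc_conjMap (n : ℕ) (g : absoluteGaloisGroup (v.adicCompletion ℚ))
    (y : H1 (W.torsionGaloisModule (N : ℤ)) (κ.layerSubgroup n)) :
    layerLoc W N κ v n (conjMap (W.torsionGaloisModule (N : ℤ)).toTopRep (κ.layerSubgroup n)
        (resGalOfEmb (closureEmb (K := ℚ) (v.adicCompletion ℚ)) g) 1 y) =
      layerConj W N κ v n g (layerLoc W N κ v n y) := by
  haveI := normal_layerGroup κ v n
  obtain ⟨φ, rfl⟩ := oneCocycleClass_surjective _ y
  unfold layerLoc layerConj
  rw [conjMap_oneCocycleClass, map_oneCocycleClass, map_oneCocycleClass, conjMap_oneCocycleClass]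
  congr 1
  apply Subtype.ext
  ext τ
  rw [contOneCocycles.pullback_apply, TopRep.hom_ofHom, conj_pullback_apply, conj_pullback_apply,
    contOneCocycles.pullback_apply, TopRep.hom_ofHom]
  have hab : subgroupConj (κ.layerSubgroup n) (resGalOfEmb (closureEmb (K := ℚ) (v.adicCompletion ℚ)) g)
        (resGalSubgroupOfEmb (κ.layerSubgroup n) (closureEmb (K := ℚ) (v.adicCompletion ℚ)) τ) =
      resGalSubgroupOfEmb (κ.layerSubgroup n) (closureEmb (K := ℚ) (v.adicCompletion ℚ))
        (subgroupConj (layerGroup κ v n) g τ) := by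
    apply Subtype.ext
    rw [subgroupConj_apply_coe, resGalSubgroupOfEmb_apply_coe, resGalSubgroupOfEmb_apply_coe, subgroupConj_apply_coe,
      map_mul, map_mul, map_inv]
  rw [hab]
  rfl

/-- **The layer Kummer map is `Γ_v`-equivariant**: `κ_{U_n}(g • Q) = g · κ_{U_n}(Q)` (`conjMap_subgroupKummerClass`).
[cite: Kobayashi2003, (8.23) (p. 18)] -/
theorem layerKummer_smul (n : ℕ) (g : absoluteGaloisGroup (v.adicCompletion ℚ)) (Q : localPoints W (v.adicCompletion ℚ))
    (hQ : Q ∈ localLayerPointsOfEmb κ (closureEmb (K := ℚ) (v.adicCompletion ℚ)) W n) :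
    layerKummer W N κ v n ⟨g • Q, smul_mem_localLayerPointsOfEmb κ (closureEmb (K := ℚ) (v.adicCompletion ℚ)) W n g hQ⟩ =
      layerConj W N κ v n g (layerKummer W N κ v n ⟨Q, hQ⟩) := by
  haveI := normal_layerGroup κ v n
  have hN : (N : ℤ) ≠ 0 := by exact_mod_cast (NeZero.ne N)
  have hroot : (N : ℤ) • W.subgroupZSMulRoot (N : ℤ) hN Q = Q := W.zsmul_subgroupZSMulRoot (N : ℤ) hN Q
  have hfix : (N : ℤ) • W.subgroupZSMulRoot (N : ℤ) hN Q ∈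
      FixedPoints.addSubgroup (layerGroup κ v n) (localPoints W (v.adicCompletion ℚ)) := by
    rw [hroot]; exact hQ
  have hgroot : (N : ℤ) • (g • W.subgroupZSMulRoot (N : ℤ) hN Q) = g • Q := by
    rw [← smul_zsmul_localPoints, hroot]
  have hgfix : (N : ℤ) • (g • W.subgroupZSMulRoot (N : ℤ) hN Q) ∈
      FixedPoints.addSubgroup (layerGroup κ v n) (localPoints W (v.adicCompletion ℚ)) := by
    rw [hgroot]; exact smul_mem_localLayerPointsOfEmb κ (closureEmb (K := ℚ) (v.adicCompletion ℚ)) W n g hQ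
  unfold layerConj
  change W.subgroupKummerMap (N : ℤ) (layerGroup κ v n) hN
      (⟨g • Q, smul_mem_localLayerPointsOfEmb κ (closureEmb (K := ℚ) (v.adicCompletion ℚ)) W n g hQ⟩ :
        FixedPoints.addSubgroup (layerGroup κ v n) (localPoints W (v.adicCompletion ℚ))) =
    conjMap (torsionLocalRep W N v) (layerGroup κ v n) g 1 (W.subgroupKummerMap (N : ℤ) (layerGroup κ v n) hN
      (⟨Q, hQ⟩ : FixedPoints.addSubgroup (layerGroup κ v n) (localPoints W (v.adicCompletion ℚ))))
  rw [W.subgroupKummerMap_apply_eq (N : ℤ) (layerGroup κ v n) hN _ _ hgfix hgroot,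
    W.subgroupKummerMap_apply_eq (N : ℤ) (layerGroup κ v n) hN _ _ hfix hroot,
    W.conjMap_subgroupKummerClass (N : ℤ) (layerGroup κ v n) hN g _ hfix hgfix]

/-- **(P2) modulo `N` — Galois invariance of the layer pairing**: for `g ∈ Γ_v` with image `g̃ ∈ Γ_ℚ`,
`⟨g̃ · y, g • Q⟩_{n,N} = ⟨y, Q⟩_{n,N}`.  Assembly: localisation and the layer Kummer map are `Γ_v`-equivariant
(`layerLoc_conjMap`, `layerKummer_smul`); Shapiro turns the conjugation by `g` into the right translation by `gU_n`
(`shapiroLift_conjMap`); the summed pairing is invariant under right translation (`cupProduct_rTransHom`).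
[cite: Kobayashi2003, (8.23) (p. 18)] [cite: SerreLocalFields1979, VII §5] -/
theorem layerPairingMod_conjMap (n : ℕ) (g : absoluteGaloisGroup (v.adicCompletion ℚ))
    (y : H1 (W.torsionGaloisModule (N : ℤ)) (κ.layerSubgroup n)) (Q : localPoints W (v.adicCompletion ℚ))
    (hQ : Q ∈ localLayerPointsOfEmb κ (closureEmb (K := ℚ) (v.adicCompletion ℚ)) W n) :
    layerPairingMod W N e hμ hadd₁ hadd₂ hgal κ v n
        (conjMap (W.torsionGaloisModule (N : ℤ)).toTopRep (κ.layerSubgroup n)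
          (resGalOfEmb (closureEmb (K := ℚ) (v.adicCompletion ℚ)) g) 1 y)
        ⟨g • Q, smul_mem_localLayerPointsOfEmb κ (closureEmb (K := ℚ) (v.adicCompletion ℚ)) W n g hQ⟩ =
      layerPairingMod W N e hμ hadd₁ hadd₂ hgal κ v n y ⟨Q, hQ⟩ := by
  haveI := normal_layerGroup κ v n
  letI : Fintype (absoluteGaloisGroup (v.adicCompletion ℚ) ⧸ layerGroup κ v n) := layerFintypeQuot κ v n
  rw [layerPairingMod_apply, layerPairingMod_apply, layerLoc_conjMap, layerKummer_smul]
  unfold layerShapiro layerSumPairing layerConj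
  rw [shapiroLift_conjMap, shapiroLift_conjMap, ContPairing.cupProduct_rTransHom, cohomologyMap_id_muLocalRep]

end Galois

end SignedKatoOffTwo.LayerPairing

end Summit.BirchSwinnertonDyer.BirchSwinnertonDyer.Theorems

end
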